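import Summits.ValiantsHypothesis.ValiantsHypothesis.Theorems.NewtonFramesTwoProductsFrameRungTwoSepKernel

/-!
# Crux `TwoProducts` (stmt-5906), line `FrameRungTwo`: the separation kernel from TORSION-FREENESS of the top relation

`…SepKernel.lean` reduced `hIX` of p603280 to the 1-D OUT kernel `hOut1D` and the separation kernel `hSep1D` ("multiplicative letter
weights cancelling below `e` but not at `e` admit an ADDITIVE separating weight system").  This file proves `hSep1D` from a purely
algebraic statement about the instance, `hNoTors1D`: in the free ℤ-module on the letters, the TOP RELATION
`r = Σ_j [a_j] − Σ_j [u_j]` is not a torsion element modulo the span of the LOWER RELATIONS `[b] − [c]` (one for each light common point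
`Σ b = Σ c ≠ e`): `N • r ∈ span_ℤ ⇒ r ∈ span_ℤ`.  Proof (`sep1D_of_noTorsion1D`): if `r ∉ span_ℚ` a rational linear functional vanishing on
the lower relations and not on `r` (`Submodule.exists_dual_map_eq_bot_of_notMem`) IS an additive separation; if `r ∈ span_ℚ`, clearing
denominators and `hNoTors1D` give `r = Σ k_ρ ρ` with `k_ρ ∈ ℤ`; evaluating the multiplicative weights on this identity (a multiplicative
evaluation `v ↦ Π_ℓ w(ℓ)^{v ℓ}`) gives `Π cf a / Π cg u = Π_ρ (−1)^{k_ρ}`, and the letter-count homomorphism gives `Σ k_ρ = 1`, so the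
weights CANCEL at `e` — contradiction.  Consequences: `shallowNeighbour_of_out1D_of_noTorsion1D` (`hOut1D ∧ hNoTors1D ⇒ hIX` verbatim) and
`crossCancel_of_out1D_of_noTorsion1D`.  Torsion-freeness held in every one of ≈ 6·10⁴ deep–deep pairs tested (memo-IX-g4 §2).
Honest scope: a REDUCTION for ONE stub of a rung strictly below the crux `TwoProducts`; nothing here bears on `VP ≠ VNP`.
[ours; setting KPTT arXiv:1308.2286 §2, §5]
-/

set_option linter.dupNamespace false

namespace Summit.ValiantsHypothesis.ValiantsHypothesis.Theorems.NewtonFramesTwoProducts.FrameRungTwoTrinomial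

open MvPolynomial
open scoped BigOperators Classical
open Summit.ValiantsHypothesis.Theorems.DissociatedFixedK (lexKey lexKey_injective)
open Summit.ValiantsHypothesis.ValiantsHypothesis.Theorems.DissociatedFixedK.Negative (emb emb_injective)

noncomputable section

section Torsion

variable {m : ℕ}

/-- Common denominator of finitely many rationals. [folklore] -/
theorem exists_common_denom (s : Finset ℚ) : ∃ N : ℕ, 0 < N ∧ ∀ q ∈ s, ∃ z : ℤ, (z : ℚ) = N * q := by
  induction s using Finset.induction_on with
  | empty => exact ⟨1, one_pos, fun q hq => absurd hq (Finset.notMem_empty q)⟩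
  | @insert q0 s hq0 ih =>
    obtain ⟨N, hN, hs⟩ := ih
    refine ⟨N * q0.den, Nat.mul_pos hN q0.den_pos, fun q hq => ?_⟩
    rcases Finset.mem_insert.1 hq with rfl | hq
    · refine ⟨N * q.num, ?_⟩
      push_cast
      rw [mul_assoc, mul_comm (q.den : ℚ) q, Rat.mul_den_eq_num]
    · obtain ⟨z, hz⟩ := hs q hq
      refine ⟨z * q0.den, ?_⟩
      push_cast
      rw [hz]; ring

/-- The evaluation `v ↦ Π w(ℓ)^{v ℓ}` is multiplicative. [folklore] -/
theorem evalZ_add {ι : Type*} (w : ι → ℂ) (hw : ∀ ℓ, w ℓ ≠ 0) (v v' : ι →₀ ℤ) :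
    Finsupp.prod (v + v') (fun ℓ n => w ℓ ^ n) = Finsupp.prod v (fun ℓ n => w ℓ ^ n) * Finsupp.prod v' (fun ℓ n => w ℓ ^ n) := by
  exact Finsupp.prod_add_index' (fun ℓ => zpow_zero _) (fun ℓ n₁ n₂ => zpow_add₀ (hw ℓ) _ _)

/-- Evaluation of a single letter. [folklore] -/
theorem evalZ_single {ι : Type*} (w : ι → ℂ) (ℓ : ι) (n : ℤ) : Finsupp.prod (Finsupp.single ℓ n) (fun ℓ n => w ℓ ^ n) = w ℓ ^ n := by
  exact Finsupp.prod_single_index (zpow_zero _)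

/-- Evaluation of `0`. [folklore] -/
theorem evalZ_zero {ι : Type*} (w : ι → ℂ) : Finsupp.prod (0 : ι →₀ ℤ) (fun ℓ n => w ℓ ^ n) = 1 := by
  exact Finsupp.prod_zero_index

/-- The evaluation is nowhere zero. [folklore] -/
theorem evalZ_ne_zero {ι : Type*} (w : ι → ℂ) (hw : ∀ ℓ, w ℓ ≠ 0) (v : ι →₀ ℤ) : Finsupp.prod v (fun ℓ n => w ℓ ^ n) ≠ 0 := by
  exact Finsupp.prod_ne_zero_iff.2 fun ℓ _ => zpow_ne_zero _ (hw ℓ)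

/-- Evaluation of a negative. [folklore] -/
theorem evalZ_neg {ι : Type*} (w : ι → ℂ) (hw : ∀ ℓ, w ℓ ≠ 0) (v : ι →₀ ℤ) : Finsupp.prod (-v) (fun ℓ n => w ℓ ^ n) = (Finsupp.prod v (fun ℓ n => w ℓ ^ n))⁻¹ := by
  have h := evalZ_add w hw v (-v)
  rw [add_neg_cancel, evalZ_zero] at h
  exact eq_inv_of_mul_eq_one_right h.symm

/-- Evaluation of an integer multiple. [folklore] -/
theorem evalZ_zsmul {ι : Type*} (w : ι → ℂ) (hw : ∀ ℓ, w ℓ ≠ 0) (n : ℤ) (v : ι →₀ ℤ) :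
    Finsupp.prod (n • v) (fun ℓ n => w ℓ ^ n) = Finsupp.prod v (fun ℓ n => w ℓ ^ n) ^ n := by
  have hnat : ∀ (k : ℕ), Finsupp.prod ((k : ℤ) • v) (fun ℓ n => w ℓ ^ n) = Finsupp.prod v (fun ℓ n => w ℓ ^ n) ^ (k : ℤ) := by
    intro k
    induction k with
    | zero => simp
    | succ k ih =>
      rw [Nat.cast_succ, add_smul, one_smul, evalZ_add w hw, ih, zpow_add₀ (evalZ_ne_zero w hw v), zpow_one]
  rcases Int.eq_nat_or_neg n with ⟨k, rfl | rfl⟩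
  · exact hnat k
  · rw [neg_smul, evalZ_neg w hw, hnat, zpow_neg]

/-- Evaluation of an integer combination. [folklore] -/
theorem evalZ_sum_zsmul {ι α : Type*} (w : ι → ℂ) (hw : ∀ ℓ, w ℓ ≠ 0) (s : Finset α) (k : α → ℤ) (v : α → (ι →₀ ℤ)) :
    Finsupp.prod (∑ i ∈ s, k i • v i) (fun ℓ n => w ℓ ^ n) = ∏ i ∈ s, Finsupp.prod (v i) (fun ℓ n => w ℓ ^ n) ^ k i := by
  induction s using Finset.induction_on with
  | empty => simp
  | @insert i s hi ih => rw [Finset.sum_insert hi, Finset.prod_insert hi, evalZ_add w hw, evalZ_zsmul w hw, ih]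

/-- Sum of single letters evaluates to the product of the weights. [folklore] -/
theorem evalZ_sum_single {ι : Type*} (w : ι → ℂ) (hw : ∀ ℓ, w ℓ ≠ 0) (ℓ : Fin m → ι) :
    Finsupp.prod (∑ j, Finsupp.single (ℓ j) (1 : ℤ)) (fun ℓ n => w ℓ ^ n) = ∏ j, w (ℓ j) := by
  have h := evalZ_sum_zsmul w hw Finset.univ (fun _ => (1 : ℤ)) (fun j => Finsupp.single (ℓ j) (1 : ℤ))
  simp only [one_smul, evalZ_single, zpow_one] at h
  exact h

/-- Powers of `−1` multiply to the power of the sum. [folklore] -/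
theorem prod_neg_one_zpow {α : Type*} (s : Finset α) (k : α → ℤ) :
    ∏ i ∈ s, (-1 : ℂ) ^ k i = (-1 : ℂ) ^ ∑ i ∈ s, k i := by
  induction s using Finset.induction_on with
  | empty => simp
  | @insert i s hi ih => rw [Finset.prod_insert hi, Finset.sum_insert hi, ih, zpow_add₀ (by norm_num : (-1 : ℂ) ≠ 0)]

/-- **The separation kernel from torsion-freeness of the top relation.**  `hSep1D` of `…SepKernel.lean` follows from `hNoTors1D`:
for every instance, with letter index `(Fin m × ℝ) ⊕ (Fin m × ℝ)`, top relation `r` and lower relation set `R` (spelled out), if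
`N • r ∈ span_ℤ R` for some `N > 0` then `r ∈ span_ℤ R`. [ours] -/
theorem sep1D_of_noTorsion1D
    (hNoTors1D : ∀ (S S' : Fin m → Finset ℝ) (e : ℝ) (a u : Fin m → ℝ) (N : ℕ), 0 < N →
      N • ((∑ j, Finsupp.single (Sum.inl (j, a j)) (1 : ℤ)) - ∑ j, Finsupp.single (Sum.inr (j, u j)) (1 : ℤ) :
          (Fin m × ℝ) ⊕ (Fin m × ℝ) →₀ ℤ) ∈
        Submodule.span ℤ ((((Fintype.piFinset S ×ˢ Fintype.piFinset S').filter fun bc =>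
            ∑ j, bc.1 j = ∑ j, bc.2 j ∧ ∑ j, bc.1 j ≠ e ∧ e ≤ ∑ j, bc.1 j).image fun bc =>
            ((∑ j, Finsupp.single (Sum.inl (j, bc.1 j)) (1 : ℤ)) - ∑ j, Finsupp.single (Sum.inr (j, bc.2 j)) (1 : ℤ) :
              (Fin m × ℝ) ⊕ (Fin m × ℝ) →₀ ℤ)) : Set ((Fin m × ℝ) ⊕ (Fin m × ℝ) →₀ ℤ)) →
      ((∑ j, Finsupp.single (Sum.inl (j, a j)) (1 : ℤ)) - ∑ j, Finsupp.single (Sum.inr (j, u j)) (1 : ℤ) :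
          (Fin m × ℝ) ⊕ (Fin m × ℝ) →₀ ℤ) ∈
        Submodule.span ℤ ((((Fintype.piFinset S ×ˢ Fintype.piFinset S').filter fun bc =>
            ∑ j, bc.1 j = ∑ j, bc.2 j ∧ ∑ j, bc.1 j ≠ e ∧ e ≤ ∑ j, bc.1 j).image fun bc =>
            ((∑ j, Finsupp.single (Sum.inl (j, bc.1 j)) (1 : ℤ)) - ∑ j, Finsupp.single (Sum.inr (j, bc.2 j)) (1 : ℤ) :
              (Fin m × ℝ) ⊕ (Fin m × ℝ) →₀ ℤ)) : Set ((Fin m × ℝ) ⊕ (Fin m × ℝ) →₀ ℤ))) :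
    ∀ (S S' : Fin m → Finset ℝ) (e : ℝ) (T T' a u : Fin m → ℝ) (cf cg : Fin m → ℝ → ℂ),
      (∀ b c : Fin m → ℝ, (∀ j, b j ∈ S j) → (∀ j, c j ∈ S j) → ∑ j, b j = ∑ j, c j → b = c) →
      (∀ b c : Fin m → ℝ, (∀ j, b j ∈ S' j) → (∀ j, c j ∈ S' j) → ∑ j, b j = ∑ j, c j → b = c) →
      (∀ j, T j ∈ S j) → (∀ j, ∀ x ∈ S j, x ≤ T j) → (∀ j, T' j ∈ S' j) → (∀ j, ∀ x ∈ S' j, x ≤ T' j) →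
      (∀ j, a j ∈ S j) → ∑ j, a j = e → (∀ j, u j ∈ S' j) → ∑ j, u j = e →
      ∑ j, T j = ∑ j, T' j → e < ∑ j, T j →
      (∀ b : Fin m → ℝ, (∀ j, b j ∈ S j) → ∑ j, b j ≠ e → e ≤ ∑ j, b j →
        ∃ c : Fin m → ℝ, (∀ j, c j ∈ S' j) ∧ ∑ j, c j = ∑ j, b j) →
      (∀ c : Fin m → ℝ, (∀ j, c j ∈ S' j) → ∑ j, c j ≠ e → e ≤ ∑ j, c j →
        ∃ b : Fin m → ℝ, (∀ j, b j ∈ S j) ∧ ∑ j, b j = ∑ j, c j) →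
      4 ≤ (Finset.univ.filter fun i => a i ≠ T i).card → 4 ≤ (Finset.univ.filter fun i => u i ≠ T' i).card →
      (∀ j, ∀ x ∈ S j, cf j x ≠ 0) → (∀ j, ∀ x ∈ S' j, cg j x ≠ 0) →
      (∀ b c : Fin m → ℝ, (∀ j, b j ∈ S j) → (∀ j, c j ∈ S' j) → ∑ j, b j = ∑ j, c j →
        ∑ j, b j ≠ e → e ≤ ∑ j, b j → ∏ j, cf j (b j) + ∏ j, cg j (c j) = 0) →
      ∏ j, cf j (a j) + ∏ j, cg j (u j) ≠ 0 →
      ∃ ψ ψ' : Fin m → ℝ → ℝ,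
        (∀ b c : Fin m → ℝ, (∀ j, b j ∈ S j) → (∀ j, c j ∈ S' j) → ∑ j, b j = ∑ j, c j →
          ∑ j, b j ≠ e → e ≤ ∑ j, b j → ∑ j, ψ j (b j) = ∑ j, ψ' j (c j)) ∧
        ∑ j, ψ j (a j) ≠ ∑ j, ψ' j (u j) := by
  intro S S' e T T' a u cf cg hS hS' hT hTmax hT' hTmax' ha hae hu hue htop hTe hwin hwin' h4 hu4 hcf hcg hcan hne
  -- letter vectors over ℤ and over ℚ
  set vZ : (Fin m → ℝ) → (Fin m → ℝ) → ((Fin m × ℝ) ⊕ (Fin m × ℝ) →₀ ℤ) := fun b c =>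
    (∑ j, Finsupp.single (Sum.inl (j, b j)) (1 : ℤ)) - ∑ j, Finsupp.single (Sum.inr (j, c j)) (1 : ℤ) with hvZ
  set vQ : (Fin m → ℝ) → (Fin m → ℝ) → ((Fin m × ℝ) ⊕ (Fin m × ℝ) →₀ ℚ) := fun b c =>
    (∑ j, Finsupp.single (Sum.inl (j, b j)) (1 : ℚ)) - ∑ j, Finsupp.single (Sum.inr (j, c j)) (1 : ℚ) with hvQ
  set Prs := (Fintype.piFinset S ×ˢ Fintype.piFinset S').filter fun bc =>
    ∑ j, bc.1 j = ∑ j, bc.2 j ∧ ∑ j, bc.1 j ≠ e ∧ e ≤ ∑ j, bc.1 j with hPrs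
  set RZ := Prs.image fun bc => vZ bc.1 bc.2 with hRZ
  set RQ := Prs.image fun bc => vQ bc.1 bc.2 with hRQ
  have hPrs_mem : ∀ bc ∈ Prs, (∀ j, bc.1 j ∈ S j) ∧ (∀ j, bc.2 j ∈ S' j) ∧ ∑ j, bc.1 j = ∑ j, bc.2 j ∧
      ∑ j, bc.1 j ≠ e ∧ e ≤ ∑ j, bc.1 j := by
    intro bc hbc
    rw [hPrs, Finset.mem_filter, Finset.mem_product] at hbc
    exact ⟨Fintype.mem_piFinset.1 hbc.1.1, Fintype.mem_piFinset.1 hbc.1.2, hbc.2.1, hbc.2.2.1, hbc.2.2.2⟩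
  -- the rational top relation and the ℚ-span of the lower relations
  set W : Submodule ℚ ((Fin m × ℝ) ⊕ (Fin m × ℝ) →₀ ℚ) := Submodule.span ℚ (RQ : Set _) with hW
  -- ℤ → ℚ comparison: the canonical map sends vZ to vQ
  set ι2Q : ((Fin m × ℝ) ⊕ (Fin m × ℝ) →₀ ℤ) →+ ((Fin m × ℝ) ⊕ (Fin m × ℝ) →₀ ℚ) :=
    Finsupp.mapRange.addMonoidHom (Int.castAddHom ℚ) with hι
  have hιv : ∀ b c, ι2Q (vZ b c) = vQ b c := by
    intro b c
    simp only [hvZ, hvQ, map_sub, map_sum, hι, Finsupp.mapRange.addMonoidHom_apply, Finsupp.mapRange_single]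
    simp
  have hιinj : Function.Injective ι2Q := by
    rw [hι]
    exact Finsupp.mapRange_injective _ (by simp) (fun x y h => Int.cast_injective (α := ℚ) h)
  by_cases hmem : vQ a u ∈ W
  · exfalso
    rw [hW, Submodule.mem_span_finset] at hmem
    obtain ⟨q, -, hq⟩ := hmem
    obtain ⟨N, hN, hden⟩ := exists_common_denom (RQ.image q)
    have hk : ∀ ρ ∈ RQ, ∃ z : ℤ, (z : ℚ) = N * q ρ := fun ρ hρ => hden _ (Finset.mem_image_of_mem q hρ)
    choose! k hk using hk
    have hNr : (N : ℚ) • vQ a u = ∑ ρ ∈ RQ, ((k ρ : ℤ) : ℚ) • ρ := by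
      rw [← hq, Finset.smul_sum]
      exact Finset.sum_congr rfl fun ρ hρ => by rw [smul_smul, hk ρ hρ]
    have hRZinj : ∀ x ∈ RZ, ∀ y ∈ RZ, ι2Q x = ι2Q y → x = y := fun x _ y _ h => hιinj h
    have hRZQ : RZ.image ι2Q = RQ := by
      rw [hRZ, hRQ, Finset.image_image]
      exact Finset.image_congr fun bc _ => hιv bc.1 bc.2
    have hNrZ : N • vZ a u = ∑ ρZ ∈ RZ, k (ι2Q ρZ) • ρZ := by
      apply hιinj
      rw [map_nsmul, map_sum, hιv, ← Nat.cast_smul_eq_nsmul ℚ, hNr, ← hRZQ, Finset.sum_image hRZinj]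
      exact Finset.sum_congr rfl fun ρZ _ => by rw [map_zsmul, Int.cast_smul_eq_zsmul]
    have hmemZ : N • vZ a u ∈ Submodule.span ℤ (RZ : Set ((Fin m × ℝ) ⊕ (Fin m × ℝ) →₀ ℤ)) := by
      rw [hNrZ]
      exact Submodule.sum_mem _ fun ρZ hρ => Submodule.smul_mem _ _ (Submodule.subset_span hρ)
    have hrZ : vZ a u ∈ Submodule.span ℤ (RZ : Set ((Fin m × ℝ) ⊕ (Fin m × ℝ) →₀ ℤ)) :=
      hNoTors1D S S' e a u N hN hmemZ
    rw [Submodule.mem_span_finset] at hrZ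
    obtain ⟨kZ, -, hkZ⟩ := hrZ
    -- weights as a nowhere-zero function on letters
    set w : (Fin m × ℝ) ⊕ (Fin m × ℝ) → ℂ := fun ℓ => Sum.elim (fun p => if p.2 ∈ S p.1 then cf p.1 p.2 else 1)
      (fun p => if p.2 ∈ S' p.1 then cg p.1 p.2 else 1) ℓ with hwdef
    have hw : ∀ ℓ, w ℓ ≠ 0 := by
      rintro (p | p) <;> simp only [hwdef, Sum.elim_inl, Sum.elim_inr] <;> split_ifs with h
      exacts [hcf p.1 p.2 h, one_ne_zero, hcg p.1 p.2 h, one_ne_zero]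
    have hevS : ∀ b : Fin m → ℝ, (∀ j, b j ∈ S j) →
        Finsupp.prod (∑ j, Finsupp.single (Sum.inl (j, b j)) (1 : ℤ)) (fun ℓ n => w ℓ ^ n) = ∏ j, cf j (b j) := by
      intro b hb
      rw [evalZ_sum_single w hw]
      exact Finset.prod_congr rfl fun j _ => by simp only [hwdef, Sum.elim_inl, if_pos (hb j)]
    have hevS' : ∀ c : Fin m → ℝ, (∀ j, c j ∈ S' j) →
        Finsupp.prod (∑ j, Finsupp.single (Sum.inr (j, c j)) (1 : ℤ)) (fun ℓ n => w ℓ ^ n) = ∏ j, cg j (c j) := by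
      intro c hc
      rw [evalZ_sum_single w hw]
      exact Finset.prod_congr rfl fun j _ => by simp only [hwdef, Sum.elim_inr, if_pos (hc j)]
    have hev : ∀ b c : Fin m → ℝ, (∀ j, b j ∈ S j) → (∀ j, c j ∈ S' j) →
        Finsupp.prod (vZ b c) (fun ℓ n => w ℓ ^ n) = (∏ j, cf j (b j)) * (∏ j, cg j (c j))⁻¹ := by
      intro b c hb hc
      simp only [hvZ]
      rw [sub_eq_add_neg, evalZ_add w hw, evalZ_neg w hw, hevS b hb, hevS' c hc]
    have hevR : ∀ ρZ ∈ RZ, Finsupp.prod ρZ (fun ℓ n => w ℓ ^ n) = -1 := by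
      intro ρZ hρ
      rw [hRZ] at hρ
      obtain ⟨bc, hbc, rfl⟩ := Finset.mem_image.1 hρ
      obtain ⟨hb, hc, hs, hne', hle⟩ := hPrs_mem bc hbc
      rw [hev bc.1 bc.2 hb hc]
      have h0 : ∏ j, cg j (bc.2 j) ≠ 0 := Finset.prod_ne_zero_iff.2 fun j _ => hcg j _ (hc j)
      have h1 := hcan bc.1 bc.2 hb hc hs hne' hle
      field_simp
      linear_combination h1
    -- letter count on the S side
    set μ : ((Fin m × ℝ) ⊕ (Fin m × ℝ) →₀ ℤ) →+ ℤ :=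
      Finsupp.liftAddHom fun ℓ => Sum.elim (fun _ => AddMonoidHom.id ℤ) (fun _ => 0) ℓ with hμ
    have hμv : ∀ b c : Fin m → ℝ, μ (vZ b c) = m := by
      intro b c
      simp only [hvZ, map_sub, map_sum, hμ, Finsupp.liftAddHom_apply_single, Sum.elim_inl, Sum.elim_inr,
        AddMonoidHom.id_apply, AddMonoidHom.zero_apply, Finset.sum_const_zero, sub_zero, Finset.sum_const,
        Finset.card_univ, Fintype.card_fin, nsmul_eq_mul, mul_one]
    have hμR : ∀ ρZ ∈ RZ, μ ρZ = m := by
      intro ρZ hρ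
      rw [hRZ] at hρ
      obtain ⟨bc, _, rfl⟩ := Finset.mem_image.1 hρ
      exact hμv bc.1 bc.2
    have hsumk : (∑ ρZ ∈ RZ, kZ ρZ) * (m : ℤ) = m := by
      have h := congrArg μ hkZ
      rw [map_sum, hμv] at h
      rw [Finset.sum_mul]
      calc ∑ ρZ ∈ RZ, kZ ρZ * (m : ℤ) = ∑ ρZ ∈ RZ, μ (kZ ρZ • ρZ) :=
            Finset.sum_congr rfl fun ρZ hρ => by rw [map_zsmul, hμR ρZ hρ, smul_eq_mul]
        _ = m := h
    have hm0 : (m : ℤ) ≠ 0 := by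
      have : 4 ≤ m := h4.trans ((Finset.card_filter_le _ _).trans (by rw [Finset.card_fin]))
      omega
    have hk1 : ∑ ρZ ∈ RZ, kZ ρZ = 1 := by
      have h : (∑ ρZ ∈ RZ, kZ ρZ - 1) * (m : ℤ) = 0 := by rw [sub_mul, hsumk, one_mul, sub_self]
      rcases mul_eq_zero.1 h with h | h
      · linarith
      · exact absurd h hm0
    -- evaluate the integer identity
    have hE := congrArg (fun v => Finsupp.prod v (fun ℓ n => w ℓ ^ n)) hkZ
    rw [evalZ_sum_zsmul w hw, hev a u ha hu] at hE
    have hE' : ∏ ρZ ∈ RZ, Finsupp.prod ρZ (fun ℓ n => w ℓ ^ n) ^ kZ ρZ = -1 := by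
      rw [Finset.prod_congr rfl fun ρZ hρ => by rw [hevR ρZ hρ], prod_neg_one_zpow, hk1, zpow_one]
    rw [hE'] at hE
    have hu0 : ∏ j, cg j (u j) ≠ 0 := Finset.prod_ne_zero_iff.2 fun j _ => hcg j _ (hu j)
    apply hne
    have : ∏ j, cf j (a j) = -∏ j, cg j (u j) := by
      have h := hE.symm
      field_simp at h
      linear_combination h
    rw [this]; ring
  · -- r ∉ span_ℚ: a rational functional killing W but not r is an additive separation
    obtain ⟨f, hfr, hfW⟩ := Submodule.exists_dual_map_eq_bot_of_notMem hmem inferInstance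
    have hf0 : ∀ ρ ∈ RQ, f ρ = 0 := by
      intro ρ hρ
      have h1 : f ρ ∈ W.map f := Submodule.mem_map_of_mem (by rw [hW]; exact Submodule.subset_span hρ)
      rw [hfW] at h1
      exact (Submodule.mem_bot ℚ).1 h1
    refine ⟨fun j x => (f (Finsupp.single (Sum.inl (j, x)) 1) : ℝ), fun j x => (f (Finsupp.single (Sum.inr (j, x)) 1) : ℝ),
      ?_, ?_⟩
    · intro b c hb hc hbc hbe hle
      have hρ : vQ b c ∈ RQ := by
        rw [hRQ]
        refine Finset.mem_image.2 ⟨(b, c), ?_, rfl⟩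
        rw [hPrs, Finset.mem_filter]
        exact ⟨Finset.mk_mem_product (Fintype.mem_piFinset.2 hb) (Fintype.mem_piFinset.2 hc), hbc, hbe, hle⟩
      have h1 := hf0 _ hρ
      simp only [hvQ, map_sub, map_sum] at h1
      have h2 : ((∑ j, f (Finsupp.single (Sum.inl (j, b j)) 1) : ℚ) : ℝ) =
          ((∑ j, f (Finsupp.single (Sum.inr (j, c j)) 1) : ℚ) : ℝ) := by
        rw [sub_eq_zero.1 h1]
      push_cast at h2
      exact h2
    · intro h
      apply hfr
      simp only [hvQ, map_sub, map_sum]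
      rw [sub_eq_zero]
      have h2 : ((∑ j, f (Finsupp.single (Sum.inl (j, a j)) 1) : ℚ) : ℝ) =
          ((∑ j, f (Finsupp.single (Sum.inr (j, u j)) 1) : ℚ) : ℝ) := by
        push_cast; exact h
      exact_mod_cast h2

/-- **(IX) from the 1-D OUT kernel and torsion-freeness**: `hIX` of `crossCancel_of_shallowNeighbour` (p603280) VERBATIM for
dissociated `f`, `g`, from `hOut1D` and `hNoTors1D`. [ours] -/
theorem shallowNeighbour_of_out1D_of_noTorsion1D (f g : Fin m → MvPolynomial (Fin 2) ℂ)
    (hinjf : ∀ a b : Fin m → (Fin 2 →₀ ℕ), (∀ j, a j ∈ (f j).support) → (∀ j, b j ∈ (f j).support) →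
      ∑ j, a j = ∑ j, b j → a = b)
    (hinjg : ∀ a b : Fin m → (Fin 2 →₀ ℕ), (∀ j, a j ∈ (g j).support) → (∀ j, b j ∈ (g j).support) →
      ∑ j, a j = ∑ j, b j → a = b)
    (hOut1D : ∀ (S S' : Fin m → Finset ℝ) (e : ℝ) (T T' a : Fin m → ℝ),
      (∀ b c : Fin m → ℝ, (∀ j, b j ∈ S j) → (∀ j, c j ∈ S j) → ∑ j, b j = ∑ j, c j → b = c) →
      (∀ b c : Fin m → ℝ, (∀ j, b j ∈ S' j) → (∀ j, c j ∈ S' j) → ∑ j, b j = ∑ j, c j → b = c) →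
      (∀ j, T j ∈ S j) → (∀ j, ∀ x ∈ S j, x ≤ T j) → (∀ j, T' j ∈ S' j) → (∀ j, ∀ x ∈ S' j, x ≤ T' j) →
      (∀ j, a j ∈ S j) → ∑ j, a j = e → ∑ j, T j = ∑ j, T' j → e < ∑ j, T j →
      (∀ b : Fin m → ℝ, (∀ j, b j ∈ S j) → ∑ j, b j ≠ e → e ≤ ∑ j, b j →
        ∃ c : Fin m → ℝ, (∀ j, c j ∈ S' j) ∧ ∑ j, c j = ∑ j, b j) →
      (∀ c : Fin m → ℝ, (∀ j, c j ∈ S' j) → ∑ j, c j ≠ e → e ≤ ∑ j, c j →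
        ∃ b : Fin m → ℝ, (∀ j, b j ∈ S j) ∧ ∑ j, b j = ∑ j, c j) →
      (∀ c : Fin m → ℝ, (∀ j, c j ∈ S' j) → ∑ j, c j ≠ e) →
      4 ≤ (Finset.univ.filter fun i => a i ≠ T i).card →
      ∃ (w : Fin m → ℝ) (p : Fin m) (y : ℝ), (∀ i, w i ∈ S' i) ∧
        (Finset.univ.filter fun i => w i ≠ T' i).card ≤ 2 ∧ y ∈ S' p ∧ e + T' p = ∑ i, w i + y)
    (hNoTors1D : ∀ (S S' : Fin m → Finset ℝ) (e : ℝ) (a u : Fin m → ℝ) (N : ℕ), 0 < N →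
      N • ((∑ j, Finsupp.single (Sum.inl (j, a j)) (1 : ℤ)) - ∑ j, Finsupp.single (Sum.inr (j, u j)) (1 : ℤ) :
          (Fin m × ℝ) ⊕ (Fin m × ℝ) →₀ ℤ) ∈
        Submodule.span ℤ ((((Fintype.piFinset S ×ˢ Fintype.piFinset S').filter fun bc =>
            ∑ j, bc.1 j = ∑ j, bc.2 j ∧ ∑ j, bc.1 j ≠ e ∧ e ≤ ∑ j, bc.1 j).image fun bc =>
            ((∑ j, Finsupp.single (Sum.inl (j, bc.1 j)) (1 : ℤ)) - ∑ j, Finsupp.single (Sum.inr (j, bc.2 j)) (1 : ℤ) :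
              (Fin m × ℝ) ⊕ (Fin m × ℝ) →₀ ℤ)) : Set ((Fin m × ℝ) ⊕ (Fin m × ℝ) →₀ ℤ)) →
      ((∑ j, Finsupp.single (Sum.inl (j, a j)) (1 : ℤ)) - ∑ j, Finsupp.single (Sum.inr (j, u j)) (1 : ℤ) :
          (Fin m × ℝ) ⊕ (Fin m × ℝ) →₀ ℤ) ∈
        Submodule.span ℤ ((((Fintype.piFinset S ×ˢ Fintype.piFinset S').filter fun bc =>
            ∑ j, bc.1 j = ∑ j, bc.2 j ∧ ∑ j, bc.1 j ≠ e ∧ e ≤ ∑ j, bc.1 j).image fun bc =>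
            ((∑ j, Finsupp.single (Sum.inl (j, bc.1 j)) (1 : ℤ)) - ∑ j, Finsupp.single (Sum.inr (j, bc.2 j)) (1 : ℤ) :
              (Fin m × ℝ) ⊕ (Fin m × ℝ) →₀ ℤ)) : Set ((Fin m × ℝ) ⊕ (Fin m × ℝ) →₀ ℤ))) :
    ∀ (lc : (Fin 2 → ℝ) →L[ℝ] ℝ) (e : Fin 2 →₀ ℕ) (T T' a : Fin m → (Fin 2 →₀ ℕ)),
      (∀ j, T j ∈ (f j).support) → (∀ j, ∀ x ∈ (f j).support, lexKey lc x ≤ lexKey lc (T j)) →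
      (∀ j, T' j ∈ (g j).support) → (∀ j, ∀ x ∈ (g j).support, lexKey lc x ≤ lexKey lc (T' j)) →
      (∀ j, a j ∈ (f j).support) → ∑ j, a j = e →
      (∀ x : Fin 2 →₀ ℕ, x ≠ e → lc (emb e) ≤ lc (emb x) → coeff x (∏ j, f j) + coeff x (∏ j, g j) = 0) →
      coeff e (∏ j, f j) + coeff e (∏ j, g j) ≠ 0 → ∑ j, T j = ∑ j, T' j → lexKey lc e < lexKey lc (∑ j, T j) →
      (Finset.univ.filter fun i => a i ≠ T i).card ≤ 3 ∨
        ∃ (w : Fin m → (Fin 2 →₀ ℕ)) (p : Fin m) (y : Fin 2 →₀ ℕ), (∀ i, w i ∈ (g i).support) ∧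
          (Finset.univ.filter fun i => w i ≠ T' i).card ≤ 2 ∧ y ∈ (g p).support ∧
          emb e = emb (∑ i, w i) - (emb (T' p) - emb y) :=
  shallowNeighbour_of_out1D_of_sep1D f g hinjf hinjg hOut1D (sep1D_of_noTorsion1D hNoTors1D)

/-- **The `k = 2` cross-cancelling count from the 1-D OUT kernel and torsion-freeness.** [ours] -/
theorem crossCancel_of_out1D_of_noTorsion1D (m t : ℕ) (A B : Fin m → Finset (Fin 2 →₀ ℕ))
    (f g : Fin m → MvPolynomial (Fin 2) ℂ)
    (hA : ∀ j, (A j).card ≤ t) (hB : ∀ j, (B j).card ≤ t)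
    (hf : ∀ j, (f j).support ⊆ A j) (hg : ∀ j, (g j).support ⊆ B j)
    (hinjA : ∀ a b : Fin m → (Fin 2 →₀ ℕ), (∀ j, a j ∈ A j) → (∀ j, b j ∈ A j) → ∑ j, a j = ∑ j, b j → a = b)
    (hinjB : ∀ a b : Fin m → (Fin 2 →₀ ℕ), (∀ j, a j ∈ B j) → (∀ j, b j ∈ B j) → ∑ j, a j = ∑ j, b j → a = b)
    (hOut1D : ∀ (S S' : Fin m → Finset ℝ) (e : ℝ) (T T' a : Fin m → ℝ),
      (∀ b c : Fin m → ℝ, (∀ j, b j ∈ S j) → (∀ j, c j ∈ S j) → ∑ j, b j = ∑ j, c j → b = c) →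
      (∀ b c : Fin m → ℝ, (∀ j, b j ∈ S' j) → (∀ j, c j ∈ S' j) → ∑ j, b j = ∑ j, c j → b = c) →
      (∀ j, T j ∈ S j) → (∀ j, ∀ x ∈ S j, x ≤ T j) → (∀ j, T' j ∈ S' j) → (∀ j, ∀ x ∈ S' j, x ≤ T' j) →
      (∀ j, a j ∈ S j) → ∑ j, a j = e → ∑ j, T j = ∑ j, T' j → e < ∑ j, T j →
      (∀ b : Fin m → ℝ, (∀ j, b j ∈ S j) → ∑ j, b j ≠ e → e ≤ ∑ j, b j →
        ∃ c : Fin m → ℝ, (∀ j, c j ∈ S' j) ∧ ∑ j, c j = ∑ j, b j) →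
      (∀ c : Fin m → ℝ, (∀ j, c j ∈ S' j) → ∑ j, c j ≠ e → e ≤ ∑ j, c j →
        ∃ b : Fin m → ℝ, (∀ j, b j ∈ S j) ∧ ∑ j, b j = ∑ j, c j) →
      (∀ c : Fin m → ℝ, (∀ j, c j ∈ S' j) → ∑ j, c j ≠ e) →
      4 ≤ (Finset.univ.filter fun i => a i ≠ T i).card →
      ∃ (w : Fin m → ℝ) (p : Fin m) (y : ℝ), (∀ i, w i ∈ S' i) ∧
        (Finset.univ.filter fun i => w i ≠ T' i).card ≤ 2 ∧ y ∈ S' p ∧ e + T' p = ∑ i, w i + y)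
    (hNoTors1D : ∀ (S S' : Fin m → Finset ℝ) (e : ℝ) (a u : Fin m → ℝ) (N : ℕ), 0 < N →
      N • ((∑ j, Finsupp.single (Sum.inl (j, a j)) (1 : ℤ)) - ∑ j, Finsupp.single (Sum.inr (j, u j)) (1 : ℤ) :
          (Fin m × ℝ) ⊕ (Fin m × ℝ) →₀ ℤ) ∈
        Submodule.span ℤ ((((Fintype.piFinset S ×ˢ Fintype.piFinset S').filter fun bc =>
            ∑ j, bc.1 j = ∑ j, bc.2 j ∧ ∑ j, bc.1 j ≠ e ∧ e ≤ ∑ j, bc.1 j).image fun bc =>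
            ((∑ j, Finsupp.single (Sum.inl (j, bc.1 j)) (1 : ℤ)) - ∑ j, Finsupp.single (Sum.inr (j, bc.2 j)) (1 : ℤ) :
              (Fin m × ℝ) ⊕ (Fin m × ℝ) →₀ ℤ)) : Set ((Fin m × ℝ) ⊕ (Fin m × ℝ) →₀ ℤ)) →
      ((∑ j, Finsupp.single (Sum.inl (j, a j)) (1 : ℤ)) - ∑ j, Finsupp.single (Sum.inr (j, u j)) (1 : ℤ) :
          (Fin m × ℝ) ⊕ (Fin m × ℝ) →₀ ℤ) ∈
        Submodule.span ℤ ((((Fintype.piFinset S ×ˢ Fintype.piFinset S').filter fun bc =>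
            ∑ j, bc.1 j = ∑ j, bc.2 j ∧ ∑ j, bc.1 j ≠ e ∧ e ≤ ∑ j, bc.1 j).image fun bc =>
            ((∑ j, Finsupp.single (Sum.inl (j, bc.1 j)) (1 : ℤ)) - ∑ j, Finsupp.single (Sum.inr (j, bc.2 j)) (1 : ℤ) :
              (Fin m × ℝ) ⊕ (Fin m × ℝ) →₀ ℤ)) : Set ((Fin m × ℝ) ⊕ (Fin m × ℝ) →₀ ℤ))) :
    {p : Fin 2 → ℝ | p ∈ Set.extremePoints ℝ (convexHull ℝ
          (emb '' ((∏ j, f j + ∏ j, g j).support : Set (Fin 2 →₀ ℕ)))) ∧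
        ∃ l : (Fin 2 → ℝ) →ₗ[ℝ] ℝ,
          (∀ q ∈ emb '' ((∏ j, f j + ∏ j, g j).support : Set (Fin 2 →₀ ℕ)), q ≠ p → l q < l p) ∧
          ∃ q ∈ emb '' ((∏ j, f j).support : Set (Fin 2 →₀ ℕ)) ∪ emb '' ((∏ j, g j).support : Set (Fin 2 →₀ ℕ)),
            l p < l q}.ncard ≤ (m * t + 2) ^ 8 :=
  crossCancel_of_out1D_of_sep1D m t A B f g hA hB hf hg hinjA hinjB hOut1D (sep1D_of_noTorsion1D hNoTors1D)

end Torsion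

end

end Summit.ValiantsHypothesis.ValiantsHypothesis.Theorems.NewtonFramesTwoProducts.FrameRungTwoTrinomial
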